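import Mathlib
import Summits.ValiantsHypothesis.ValiantsHypothesis.Theorems.RigidityForcesSymmetryRankRigidMinimalReprLaplaceFourDefs
import Summits.ValiantsHypothesis.ValiantsHypothesis.Theorems.RigidityForcesSymmetryRankRigidMinimalReprLaplaceFourPencil
import Summits.ValiantsHypothesis.ValiantsHypothesis.Theorems.RigidityForcesSymmetryRankRigidMinimalReprLaplaceFourContraction
import Summits.ValiantsHypothesis.ValiantsHypothesis.Theorems.RigidityForcesSymmetryRankRigidMinimalReprLaplaceFourEasy
import Summits.ValiantsHypothesis.ValiantsHypothesis.Theorems.RigidityForcesSymmetryRankRigidMinimalReprLaplaceFourGeneric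

/-!
# LINE profiles of `LaplaceOptimal 4`, stage A: one of the ten line families kills the noise identically
# (crux `RankRigidMinimalRepr`, stmt-ValiantsHypothesis-18034, route `RigidityForcesSymmetry`)

The five LINE profiles of the exact analysis of `LaplaceOptimal 4` are, in canonical position (contraction of slots
`0,1`), split-rank-one decompositions of `P₄` with at most THREE noise terms (`S_t ∈ {{0},{0,1}}`: slice at `0`, pair on
`01|23`) and at most TWO rank-one terms (`S_t ∈ {{0,2},{0,3},{2}}`).  For every `φ` in the torus the common kernel `K_φ`
of the (at most three) noise functionals is non-zero, and on it `Q_{ψ,φ}` is a sum of two rank-one products, so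
(`torus_ten_lines`) `K_φ` contains one of the ten lines `lineVec d φ` (`d` = star `i` or matching `(i,j)`); the noise
contraction at `(lineVec d φ, φ)` is a matrix of polynomials in `φ`, so the covering lemma gives ONE `d` that works for
all `φ`:

* `line_core` — `∃ d, ∀ φ, Σ_{noise} contract₀₁ (X t) (lineVec d φ) φ = 0`.

Stage B (`…LaplaceFourLine*.lean`) derives the contradiction from this identity profile by profile.  The two `def`s
(`lineVec`, `noiseGen`) encode the line families and the generic noise formula.  HONEST FRAMING: bookkeeping toward
`LaplaceOptimal 4` (rung `TiedTorusBound 3`); the crux stays OPEN; nothing here bears on `VP ≠ VNP`.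
-/

set_option autoImplicit false

-- the mandated summit-side namespace repeats a component by design (single-problem summit)
set_option linter.dupNamespace false

namespace Summit.ValiantsHypothesis.ValiantsHypothesis.Theorems.RigidityForcesSymmetryRankRigidMinimalRepr

namespace LaplaceFourLine

open Matrix LaplaceFourPencil LaplaceFourContraction LaplaceFourEasy LaplaceFourGeneric

/-! ### §1 The ten line families and the generic noise formula -/

/-- The ten line families at `φ`: `inl i` = the star (`ψ_i = φ_i`, `ψ_k = -φ_k` otherwise), `inr (i,j)` = the matching
`ψ = φ_i e_i - φ_j e_j` (meaningful for `i ≠ j`).  Written over any ring so that `φ` may be a generic point. -/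
def lineVec {R : Type*} [CommRing R] : Fin 4 ⊕ (Fin 4 × Fin 4) → (Fin 4 → R) → (Fin 4 → R)
  | Sum.inl i, φ => fun k => if k = i then φ k else -φ k
  | Sum.inr p, φ => fun k => if k = p.1 then φ k else if k = p.2 then -φ k else 0

/-- The generic shape of a NOISE term after contracting slots `0,1`: a functional of `ψ` (affine in `φ`) times a matrix
affine in `φ` — over any `ℂ`-algebra, constants entering through `algebraMap`. -/
def noiseGen {R : Type*} [CommRing R] [Algebra ℂ R] (g₀ : Fin 4 → ℂ) (G : Fin 4 → Fin 4 → ℂ)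
    (N₀ : Fin 4 → Fin 4 → ℂ) (N₁ : Fin 4 → Fin 4 → Fin 4 → ℂ) (ψ φ : Fin 4 → R) : Matrix (Fin 4) (Fin 4) R :=
  (∑ x, ψ x * (algebraMap ℂ R (g₀ x) + ∑ y, algebraMap ℂ R (G x y) * φ y)) •
    Matrix.of fun i j => algebraMap ℂ R (N₀ i j) + ∑ y, φ y * algebraMap ℂ R (N₁ y i j)

/-- `lineVec` commutes with ring homomorphisms. -/
theorem lineVec_map {R S : Type*} [CommRing R] [CommRing S] (f : R →+* S) (d : Fin 4 ⊕ (Fin 4 × Fin 4))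
    (φ : Fin 4 → R) : f ∘ lineVec d φ = lineVec d (f ∘ φ) := by
  rcases d with i | ⟨i, j⟩ <;> funext k <;> simp [lineVec, apply_ite f]

/-- `noiseGen` commutes with `ℂ`-algebra homomorphisms. -/
theorem noiseGen_map {R S : Type*} [CommRing R] [CommRing S] [Algebra ℂ R] [Algebra ℂ S] (f : R →ₐ[ℂ] S)
    (g₀ : Fin 4 → ℂ) (G : Fin 4 → Fin 4 → ℂ) (N₀ : Fin 4 → Fin 4 → ℂ) (N₁ : Fin 4 → Fin 4 → Fin 4 → ℂ)
    (ψ φ : Fin 4 → R) :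
    (noiseGen g₀ G N₀ N₁ ψ φ).map f = noiseGen g₀ G N₀ N₁ (f ∘ ψ) (f ∘ φ) := by
  ext i j
  simp [noiseGen, map_sum, map_mul, map_add, AlgHom.commutes]

/-- A noise term of canonical type (`S = {0}` or `S = {0,1}`) has the generic shape over `ℂ`. -/
theorem noise_shape {X : (Fin 4 → Fin 4) → ℂ} {S : Finset (Fin 4)} (hX : IsSplitTerm S X)
    (hS : S = {0} ∨ S = {0, 1}) :
    ∃ (g₀ : Fin 4 → ℂ) (G : Fin 4 → Fin 4 → ℂ) (N₀ : Fin 4 → Fin 4 → ℂ) (N₁ : Fin 4 → Fin 4 → Fin 4 → ℂ),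
      ∀ ψ φ : Fin 4 → ℂ, contract₀₁ X ψ φ = noiseGen g₀ G N₀ N₁ ψ φ := by
  obtain ⟨u, w, hu, hw, hX'⟩ := hX
  rcases hS with rfl | rfl
  · refine ⟨fun x => u ![x, 0, 0, 0], 0, 0, fun y i j => w ![0, y, i, j], fun ψ φ => ?_⟩
    rw [contract_congr hX']
    ext i j
    have hu' : ∀ x y, u ![x, y, i, j] = u ![x, 0, 0, 0] := fun x y =>
      hu _ _ (fun k hk => by fin_cases k <;> simp at hk ⊢)
    have hw' : ∀ x y, w ![x, y, i, j] = w ![0, y, i, j] := fun x y =>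
      hw _ _ (fun k hk => by fin_cases k <;> simp at hk ⊢)
    simp only [contract₀₁, noiseGen, Matrix.of_apply, Matrix.smul_apply, smul_eq_mul, Pi.zero_apply,
      Algebra.algebraMap_self, RingHom.id_apply, zero_mul, Finset.sum_const_zero, add_zero, zero_add]
    simp_rw [hu', hw']
    rw [Finset.sum_mul_sum]
    exact Finset.sum_congr rfl fun x _ => Finset.sum_congr rfl fun y _ => by ring
  · refine ⟨0, fun x y => u ![x, y, 0, 0], fun i j => w ![0, 0, i, j], 0, fun ψ φ => ?_⟩
    rw [contract_congr hX']
    ext i j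
    have hu' : ∀ x y, u ![x, y, i, j] = u ![x, y, 0, 0] := fun x y =>
      hu _ _ (fun k hk => by fin_cases k <;> simp at hk ⊢)
    have hw' : ∀ x y, w ![x, y, i, j] = w ![0, 0, i, j] := fun x y =>
      hw _ _ (fun k hk => by fin_cases k <;> simp at hk ⊢)
    simp only [contract₀₁, noiseGen, Matrix.of_apply, Matrix.smul_apply, smul_eq_mul, Pi.zero_apply,
      Algebra.algebraMap_self, RingHom.id_apply, mul_zero, Finset.sum_const_zero, add_zero, zero_add]
    simp_rw [hu', hw']
    rw [Finset.sum_mul]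
    refine Finset.sum_congr rfl fun x _ => ?_
    rw [Finset.mul_sum, Finset.sum_mul]
    exact Finset.sum_congr rfl fun y _ => by ring

/-- The noise shape is «functional of `ψ`» times «matrix»: scaling `ψ` scales the term. -/
theorem noiseGen_smul (g₀ : Fin 4 → ℂ) (G : Fin 4 → Fin 4 → ℂ) (N₀ : Fin 4 → Fin 4 → ℂ)
    (N₁ : Fin 4 → Fin 4 → Fin 4 → ℂ) (c : ℂ) (ψ φ : Fin 4 → ℂ) :
    noiseGen g₀ G N₀ N₁ (c • ψ) φ = c • noiseGen g₀ G N₀ N₁ ψ φ := by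
  simp only [noiseGen, Pi.smul_apply, smul_eq_mul, smul_smul]
  congr 1
  rw [Finset.mul_sum]
  exact Finset.sum_congr rfl fun x _ => by ring

/-- The functional of a noise term: if it vanishes, the term vanishes. -/
theorem noiseGen_eq_zero_of (g₀ : Fin 4 → ℂ) (G : Fin 4 → Fin 4 → ℂ) (N₀ : Fin 4 → Fin 4 → ℂ)
    (N₁ : Fin 4 → Fin 4 → Fin 4 → ℂ) (ψ φ : Fin 4 → ℂ)
    (h : ∑ x, (g₀ x + ∑ y, G x y * φ y) * ψ x = 0) : noiseGen g₀ G N₀ N₁ ψ φ = 0 := by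
  simp only [noiseGen, Algebra.algebraMap_self, RingHom.id_apply]
  rw [show (∑ x, ψ x * (g₀ x + ∑ y, G x y * φ y)) = 0 from by
    rw [← h]; exact Finset.sum_congr rfl fun x _ => by ring]
  rw [zero_smul]


/-- A rank-one term of canonical type (`S ∈ {{0,2},{0,3},{2}}`) is a rank-one matrix for every `ψ, φ`. -/
theorem rank_one_shape {X : (Fin 4 → Fin 4) → ℂ} {S : Finset (Fin 4)} (hX : IsSplitTerm S X)
    (hS : S = {0, 2} ∨ S = {0, 3} ∨ S = {2}) (ψ φ : Fin 4 → ℂ) :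
    ∃ c r : Fin 4 → ℂ, contract₀₁ X ψ φ = vecMulVec c r := by
  obtain ⟨u, w, hu, hw, hX'⟩ := hX
  rw [contract_congr hX']
  rcases hS with rfl | rfl | rfl
  · obtain ⟨b, b', hb⟩ := contract_term_02 hu hw
    exact ⟨_, _, hb ψ φ⟩
  · obtain ⟨c, c', hc⟩ := contract_term_03 hu hw
    exact ⟨_, _, hc ψ φ⟩
  · obtain ⟨f, hf⟩ := contract_term_2 hu hw
    obtain ⟨r, hr⟩ := hf ψ φ
    exact ⟨f, r, hr⟩

/-! ### §2 Stage A: one line family kills the noise for every `φ` -/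

/-- **LINE profiles, stage A.**  For a split-rank-one decomposition of `P₄` in canonical position with at most three
noise terms (`S_t ∈ {{0},{0,1}}`) and at most two rank-one terms (`S_t ∈ {{0,2},{0,3},{2}}`), ONE of the ten line
families `ψ = lineVec d φ` annihilates the noise part of the contraction for EVERY `φ ∈ ℂ⁴`. -/
theorem line_core {ι : Type*} (T : Finset ι) (X : ι → (Fin 4 → Fin 4) → ℂ) (S : ι → Finset (Fin 4))
    (hX : ∀ t ∈ T, IsSplitTerm (S t) (X t))
    (hS : ∀ t ∈ T, S t = {0} ∨ S t = {0, 1} ∨ S t = {0, 2} ∨ S t = {0, 3} ∨ S t = {2})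
    (hsum : ∀ v, permPattern₄ v = ∑ t ∈ T, X t v)
    (hN : (T.filter fun t => S t = {0} ∨ S t = {0, 1}).card ≤ 3)
    (hR : (T.filter fun t => ¬(S t = {0} ∨ S t = {0, 1})).card ≤ 2) :
    ∃ d : Fin 4 ⊕ (Fin 4 × Fin 4), (∀ p, d = Sum.inr p → p.1 ≠ p.2) ∧
      ∀ φ : Fin 4 → ℂ, ∑ t ∈ T.filter (fun t => S t = {0} ∨ S t = {0, 1}),
        contract₀₁ (X t) (lineVec d φ) φ = 0 := by
  classical
  set N := T.filter fun t => S t = {0} ∨ S t = {0, 1} with hNdef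
  set R := T.filter fun t => ¬(S t = {0} ∨ S t = {0, 1}) with hRdef
  -- shapes of the noise terms
  have hshape : ∀ t ∈ N, ∃ (g₀ : Fin 4 → ℂ) (G : Fin 4 → Fin 4 → ℂ) (N₀ : Fin 4 → Fin 4 → ℂ)
      (N₁ : Fin 4 → Fin 4 → Fin 4 → ℂ), ∀ ψ φ : Fin 4 → ℂ, contract₀₁ (X t) ψ φ = noiseGen g₀ G N₀ N₁ ψ φ := by
    intro t ht
    rw [hNdef, Finset.mem_filter] at ht
    exact noise_shape (hX t ht.1) ht.2
  choose! g₀ G N₀ N₁ hng using hshape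
  -- rank-one terms
  have hrank : ∀ t ∈ R, ∀ ψ φ : Fin 4 → ℂ, ∃ c r : Fin 4 → ℂ, contract₀₁ (X t) ψ φ = vecMulVec c r := by
    intro t ht ψ φ
    rw [hRdef, Finset.mem_filter] at ht
    have h5 := hS t ht.1
    have h3 : S t = {0, 2} ∨ S t = {0, 3} ∨ S t = {2} := by tauto
    exact rank_one_shape (hX t ht.1) h3 ψ φ
  have hTNR : T = N ∪ R := by rw [hNdef, hRdef]; exact (Finset.filter_union_filter_not_eq _ T).symm
  have hdisj : Disjoint N R := by rw [hNdef, hRdef]; exact Finset.disjoint_filter_filter_not T T _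
  -- the polynomial matrices `P_d = Σ_{noise} noiseGen (lineVec d X, X)`
  let Xv : Fin 4 → MvPolynomial (Fin 4) ℂ := fun i => MvPolynomial.X i
  let Pd : Fin 4 ⊕ (Fin 4 × Fin 4) → Matrix (Fin 4) (Fin 4) (MvPolynomial (Fin 4) ℂ) := fun d =>
    ∑ t ∈ N, noiseGen (g₀ t) (G t) (N₀ t) (N₁ t) (lineVec d Xv) Xv
  have hPd : ∀ d (φ : Fin 4 → ℂ), (Pd d).map (MvPolynomial.eval φ) =
      ∑ t ∈ N, contract₀₁ (X t) (lineVec d φ) φ := by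
    intro d φ
    rw [show (Pd d).map (MvPolynomial.eval φ) = (MvPolynomial.eval φ).mapMatrix (Pd d) from rfl]
    simp only [Pd, map_sum]
    refine Finset.sum_congr rfl fun t ht => ?_
    rw [RingHom.mapMatrix_apply]
    have := noiseGen_map (MvPolynomial.aeval φ : MvPolynomial (Fin 4) ℂ →ₐ[ℂ] ℂ) (g₀ t) (G t) (N₀ t) (N₁ t)
      (lineVec d Xv) Xv
    have hcoe : ((MvPolynomial.aeval φ : MvPolynomial (Fin 4) ℂ →ₐ[ℂ] ℂ) : MvPolynomial (Fin 4) ℂ → ℂ) =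
        MvPolynomial.eval φ := by
      funext p; exact (MvPolynomial.aeval_eq_eval₂Hom φ p)
    rw [hcoe] at this
    rw [hng t ht, this]
    have hlv : (MvPolynomial.eval φ : MvPolynomial (Fin 4) ℂ → ℂ) ∘ lineVec d Xv = lineVec d φ := by
      have := lineVec_map (MvPolynomial.eval φ) d Xv
      rw [this]
      congr 1; funext i; simp [Xv]
    have hX : (MvPolynomial.eval φ : MvPolynomial (Fin 4) ℂ → ℂ) ∘ Xv = φ := by funext i; simp [Xv]
    rw [hlv, hX]
  -- pointwise on the torus: some valid `d` kills the noise
  have hpt : ∀ φ : Fin 4 → ℂ, (∀ i, φ i ≠ 0) → ∃ d : {d : Fin 4 ⊕ (Fin 4 × Fin 4) // ∀ p, d = Sum.inr p → p.1 ≠ p.2},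
      ∀ k : Fin 4 × Fin 4, MvPolynomial.eval φ (Pd d.1 k.1 k.2) = 0 := by
    intro φ hφ
    -- a non-zero `ψ` in the common kernel of the noise functionals
    obtain ⟨A, hA⟩ := exists_matrix_of_card_le N hN (fun t x => g₀ t x + ∑ y, G t x y * φ y)
    obtain ⟨ψ, hψ0, hψ⟩ := exists_ne_zero_of_three_conditions A
    have hker := hA ψ hψ
    have hQ : contract₀₁ permPattern₄ ψ φ = ∑ t ∈ R, contract₀₁ (X t) ψ φ := by
      rw [contract_congr hsum, contract_sum, hTNR, Finset.sum_union hdisj, Finset.sum_eq_zero, zero_add]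
      intro t ht
      rw [hng t ht]
      exact noiseGen_eq_zero_of _ _ _ _ _ _ (hker t ht)
    obtain ⟨a, b, a', b', hab⟩ := sum_rank_one_of_card_le_two R hR (fun t => contract₀₁ (X t) ψ φ)
      (fun t ht => hrank t ht ψ φ)
    rw [hab] at hQ
    -- `ψ` lies on one of the ten lines: `ψ = c • lineVec d φ`
    have hline : ∃ d : {d : Fin 4 ⊕ (Fin 4 × Fin 4) // ∀ p, d = Sum.inr p → p.1 ≠ p.2}, ∃ c : ℂ,
        ψ = c • lineVec d.1 φ := by
      rcases torus_ten_lines ψ φ hφ a b a' b' hQ with ⟨i, c, hc⟩ | ⟨i, j, hij, hk, hs⟩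
      · refine ⟨⟨Sum.inl i, fun p hp => by cases hp⟩, c, funext fun k => ?_⟩
        simp only [Pi.smul_apply, lineVec, smul_eq_mul]
        rw [hc k]; split_ifs <;> ring
      · refine ⟨⟨Sum.inr (i, j), fun p hp => by cases hp; exact hij⟩, ψ i / φ i, funext fun k => ?_⟩
        simp only [Pi.smul_apply, lineVec, smul_eq_mul]
        by_cases hki : k = i
        · subst hki; rw [if_pos rfl]; exact (div_mul_cancel₀ _ (hφ k)).symm
        · rw [if_neg hki]
          by_cases hkj : k = j
          · subst hkj; rw [if_pos rfl]
            have h1 : ψ k / φ k = -(ψ i / φ i) := by linear_combination hs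
            rw [(div_eq_iff (hφ k)).1 h1]; ring
          · rw [if_neg hkj, mul_zero]; exact hk k hki hkj
    obtain ⟨d, c, hψc⟩ := hline
    have hc0 : c ≠ 0 := by rintro rfl; exact hψ0 (by rw [hψc, zero_smul])
    refine ⟨d, fun k => ?_⟩
    have hmat := hPd d.1 φ
    have hzero : ∑ t ∈ N, contract₀₁ (X t) (lineVec d.1 φ) φ = 0 := by
      have : lineVec d.1 φ = c⁻¹ • ψ := by rw [hψc, smul_smul, inv_mul_cancel₀ hc0, one_smul]
      rw [this]
      refine Finset.sum_eq_zero fun t ht => ?_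
      rw [hng t ht, noiseGen_smul, noiseGen_eq_zero_of _ _ _ _ _ _ (hker t ht), smul_zero]
    have := congrFun (congrFun hmat k.1) k.2
    rw [hzero] at this
    simpa using this
  -- covering
  obtain ⟨d, hd⟩ := covering (fun (d : {d : Fin 4 ⊕ (Fin 4 × Fin 4) // ∀ p, d = Sum.inr p → p.1 ≠ p.2})
    (k : Fin 4 × Fin 4) => Pd d.1 k.1 k.2) hpt
  refine ⟨d.1, d.2, fun φ => ?_⟩
  rw [← hPd d.1 φ]
  ext i j
  simp only [Matrix.map_apply, Matrix.zero_apply, hd (i, j), map_zero]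


/-! ### §3 Relabelling the letters -/

/-- Relabelling the LETTERS (values) by `π`: `(letterPerm π X)(v) = X(π ∘ v)`.  The pattern is invariant and dependence
sets are unchanged, so every profile is preserved; the line families are permuted. -/
def letterPerm (π : Equiv.Perm (Fin 4)) (X : (Fin 4 → Fin 4) → ℂ) : (Fin 4 → Fin 4) → ℂ := fun v => X (π ∘ v)

/-- The action of a letter relabelling on line descriptors. -/
def permDescr (π : Equiv.Perm (Fin 4)) : Fin 4 ⊕ (Fin 4 × Fin 4) → Fin 4 ⊕ (Fin 4 × Fin 4)
  | Sum.inl i => Sum.inl (π i)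
  | Sum.inr p => Sum.inr (π p.1, π p.2)

/-- The pattern is invariant under relabelling the letters. -/
theorem letterPerm_permPattern (π : Equiv.Perm (Fin 4)) : letterPerm π permPattern₄ = permPattern₄ := by
  funext v
  simp only [letterPerm, permPattern₄]
  have : Function.Injective (π ∘ v) ↔ Function.Injective v :=
    ⟨fun h => by
      have := π.symm.injective.comp h
      simpa [Function.comp_assoc] using this, fun h => π.injective.comp h⟩
  rw [if_congr this rfl rfl]

/-- Relabelling letters preserves split terms (same dependence set). -/
theorem isSplitTerm_letterPerm (π : Equiv.Perm (Fin 4)) {S : Finset (Fin 4)} {X : (Fin 4 → Fin 4) → ℂ}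
    (hX : IsSplitTerm S X) : IsSplitTerm S (letterPerm π X) := by
  obtain ⟨u, w, hu, hw, hX⟩ := hX
  refine ⟨letterPerm π u, letterPerm π w, fun v v' h => hu _ _ fun i hi => ?_,
    fun v v' h => hw _ _ fun i hi => ?_, fun v => by simp only [letterPerm, hX]⟩
  · simp only [Function.comp_apply, h i hi]
  · simp only [Function.comp_apply, h i hi]

/-- Relabelling letters in a sum of tensors. -/
theorem letterPerm_sum {ι : Type*} (π : Equiv.Perm (Fin 4)) (s : Finset ι) (Y : ι → (Fin 4 → Fin 4) → ℂ) :
    letterPerm π (fun v => ∑ k ∈ s, Y k v) = fun v => ∑ k ∈ s, letterPerm π (Y k) v := rfl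

/-- How contraction interacts with relabelling the letters. -/
theorem contract_letterPerm (π : Equiv.Perm (Fin 4)) (X : (Fin 4 → Fin 4) → ℂ) (ψ φ : Fin 4 → ℂ) (z w : Fin 4) :
    contract₀₁ (letterPerm π X) ψ φ z w = contract₀₁ X (ψ ∘ π.symm) (φ ∘ π.symm) (π z) (π w) := by
  simp only [contract₀₁, Matrix.of_apply, letterPerm, Function.comp_apply]
  have hvec : ∀ x y : Fin 4, (π ∘ ![x, y, z, w]) = ![π x, π y, π z, π w] := fun x y => by
    funext i; fin_cases i <;> rfl
  simp_rw [hvec]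
  rw [← Equiv.sum_comp π (fun x => ∑ y, ψ (π.symm x) * φ (π.symm y) * X ![x, y, π z, π w])]
  refine Finset.sum_congr rfl fun x _ => ?_
  rw [← Equiv.sum_comp π (fun y => ψ (π.symm (π x)) * φ (π.symm y) * X ![π x, y, π z, π w])]
  refine Finset.sum_congr rfl fun y _ => ?_
  simp only [Equiv.symm_apply_apply]

/-- The line families are permuted by a relabelling: `lineVec d' φ ∘ π⁻¹ = lineVec (π•d') (φ ∘ π⁻¹)`. -/
theorem lineVec_comp_perm (π : Equiv.Perm (Fin 4)) (d : Fin 4 ⊕ (Fin 4 × Fin 4)) (φ : Fin 4 → ℂ) :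
    lineVec d φ ∘ π.symm = lineVec (permDescr π d) (φ ∘ π.symm) := by
  rcases d with i | ⟨i, j⟩ <;> funext k <;>
    simp only [lineVec, permDescr, Function.comp_apply, Equiv.symm_apply_eq]

/-- **Transport of the stage-A identity.**  If the noise of `X` is annihilated along the family `permDescr π d`, then the
noise of the relabelled decomposition `letterPerm π ∘ X` is annihilated along the family `d`. -/
theorem noise_identity_letterPerm {ι : Type*} (π : Equiv.Perm (Fin 4)) (N : Finset ι)
    (X : ι → (Fin 4 → Fin 4) → ℂ) (d : Fin 4 ⊕ (Fin 4 × Fin 4))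
    (h : ∀ φ : Fin 4 → ℂ, ∑ t ∈ N, contract₀₁ (X t) (lineVec (permDescr π d) φ) φ = 0) :
    ∀ φ : Fin 4 → ℂ, ∑ t ∈ N, contract₀₁ (letterPerm π (X t)) (lineVec d φ) φ = 0 := by
  intro φ
  ext z w
  rw [Matrix.sum_apply, Matrix.zero_apply]
  simp_rw [contract_letterPerm, lineVec_comp_perm]
  have := congrFun (congrFun (h (φ ∘ π.symm)) (π z)) (π w)
  rwa [Matrix.sum_apply, Matrix.zero_apply] at this

end LaplaceFourLine

end Summit.ValiantsHypothesis.ValiantsHypothesis.Theorems.RigidityForcesSymmetryRankRigidMinimalRepr
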